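import Literature.NumberTheory.Automorphic.UnitaryTwoRamifiedTreeStabilizers   -- ★ p843857 (this seat): the four (W2) heads in `glVertexAct` currency
import Literature.NumberTheory.Automorphic.UnitaryTwoRamifiedTreeAction        -- ★ B-p08 (g28) (W1c)-B at the place: `rhoVertexActPlace`, `rhoVertexActPlace_eq_iff_exists_zpow`
import HarnessLib

/-!
# The (W2) stabiliser heads keyed on B-p08's place action `rhoVertexActPlace` (ED. 2 of ★ `UnitaryTwoRamifiedTreeStabilizers`)
(Tits (1979) §2.7, §3.9; Serre, *Trees* II.1.3)

Topic `NumberTheory/Automorphic`; namespace `Literature.NumberTheory.Automorphic.UnitaryGroup`.  KERNEL mathematics only: theorems, no definition, no named fact,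
no instance, no notation, no `sorry`.  Cell `pub/hodgecm-mathlib`, F0∕P3a, crux H413 = `stmt-HodgeConjecture-24833`, line «N6nsGerm», residue «R2EP-wild»,
ROAD W (W2) — the `hKv`∕`hKe` binders of ★ `rankOneEulerPoincareNonsplit_of_treeActions` (B-p10 (g26) junction p843833) ∕ ★ p843743 `_local`∕`_local'` with
`act := rhoVertexActPlace L v w hw hα hα0 hϖF` (★ B-p08 p843858), DISCHARGED from ★ p843857 (heads over `glVertexAct hϖ g` + descent) through ★
`rhoVertexActPlace_eq_iff_exists_zpow` (any representative computes `ρ_w`).  Seat F0P3a-p04 (g14); owner B-p10 (g26) WORD W-1∕W-2 (triples of record: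
`D_η := glDiagonal ![1, η]`, √u `(x₀, x₁) = (v₀, v₁)`, √π `(x₀, x₁) = (v₁, v₀)`).  HONEST LABEL: HC_CM is proved only modulo the printed citations until rung 0
closes; nothing printed is asserted here.

HEADS (`U_w := unitaryGroupOfForm σ_w (Φ₂)_w`, `u : ↥U_w`, `ρ := rhoVertexActPlace L v w hw hα hα0 hϖF`, `v₀ = latt 1`, `v₁ = latt diag(1, ϖF)`, `η` a uniformiser unit of `L_w`):
* √u-TYPE (`|α|_w = 1`): `forall_coe_mem_glInt_iff_rhoVertexActPlace_root_eq` (`K ↔ ρ u v₀ = v₀`, any non-split `w`) and, `w` ramified,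
  `forall_coe_mem_map_conj_glDiagonal_iff_sym2_rhoVertexActPlace_eq` (`K♯_{D_η} ↔ s(ρ u v₀, ρ u v₁) = s(v₀, v₁)`);
* √π-TYPE (`|α|_w = exp(−1)`), `w` ramified: `forall_coe_mem_map_conj_glDiagonal_iff_rhoVertexActPlace_next_eq` (`K♯_{D_η} ↔ ρ u v₁ = v₁`) and
  `forall_coe_mem_glInt_iff_sym2_rhoVertexActPlace_eq` (`K ↔ s(ρ u v₁, ρ u v₀) = s(v₁, v₀)`).

## References
* [Tits1979] J. Tits, *Reductive groups over local fields*, PSPM 33.1 (1979), §2.7, §3.9.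
* [Serre1980Trees] J.-P. Serre, *Trees* (1980), Ch. II §1.3.
* [Kottwitz1988] R. E. Kottwitz, *Tamagawa numbers*, Ann. of Math. 127 (1988), §2.
-/

set_option autoImplicit false

noncomputable section

open scoped WithZero ValuativeRel Matrix MatrixGroups
open Matrix WithZero ValuativeRel NumberField IsDedekindDomain

namespace Literature.NumberTheory.Automorphic.UnitaryGroup

open Literature.NumberTheory.Automorphic Literature.NumberTheory.Automorphic.HermitianLatticeTree

section Place

variable (L : Type) [Field L] [NumberField L] [IsCMField L] (v : HeightOneSpectrum (𝓞 ↥(maximalRealSubfield L)))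
  (w : PlacesOver L v) (hw : IsCMField.complexConj L • w.1 = w.1)
  {α : w.1.adicCompletion L} (hα : galAdicCompletionMap (L := L) (IsCMField.complexConj L) hw α = -α) (hα0 : α ≠ 0)
  {ϖF : v.adicCompletion ↥(maximalRealSubfield L)} (hϖF : Valued.v ϖF = exp (-1 : ℤ))
  (v₀ v₁ : {M : Submodule 𝒪[v.adicCompletion ↥(maximalRealSubfield L)] (Fin 2 → v.adicCompletion ↥(maximalRealSubfield L)) //
      IsSpecialLattice (RingHom.id (v.adicCompletion ↥(maximalRealSubfield L))) ϖF !![(0 : v.adicCompletion ↥(maximalRealSubfield L)), 1; -1, 0] M})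
  (hv₀ : v₀.1 = latt (1 : Matrix (Fin 2) (Fin 2) (v.adicCompletion ↥(maximalRealSubfield L))))
  (hv₁ : v₁.1 = latt (Matrix.diagonal ![(1 : v.adicCompletion ↥(maximalRealSubfield L)), ϖF]))

/-- **ANY DESCENT DATUM COMPUTES `ρ_w` AS `glVertexAct`**: `ρ_w(u) · M = N ↔ g · M = N` whenever `diag(1,α) u diag(1,α)⁻¹ = s · ι_w(g)`, `s ≠ 0`
(★ `rhoVertexActPlace_eq_iff_exists_zpow` + ★ `glVertexAct_eq_iff`). [cite: Serre1980Trees, Ch. II §1.3] -/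
theorem rhoVertexActPlace_eq_iff_glVertexAct_eq [IsDiscreteValuationRing 𝒪[v.adicCompletion ↥(maximalRealSubfield L)]]
    (u : ↥(unitaryGroupOfForm (galAdicCompletionMap (L := L) (IsCMField.complexConj L) hw)
      (placeForm (Matrix.of fun i j : Fin 2 => if i.val + j.val + 1 = 2 then (1 : L) else 0) w.1)))
    {s : w.1.adicCompletion L} {g : GL (Fin 2) (v.adicCompletion ↥(maximalRealSubfield L))} (hs : s ≠ 0)
    (hsg : diagonal ![1, α] * ((u : GL (Fin 2) (w.1.adicCompletion L)) : Matrix (Fin 2) (Fin 2) (w.1.adicCompletion L)) * diagonal ![1, α⁻¹] =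
      s • ((g : Matrix (Fin 2) (Fin 2) (v.adicCompletion ↥(maximalRealSubfield L))).map (toPlace v w)))
    (M N : {M : Submodule 𝒪[v.adicCompletion ↥(maximalRealSubfield L)] (Fin 2 → v.adicCompletion ↥(maximalRealSubfield L)) //
      IsSpecialLattice (RingHom.id (v.adicCompletion ↥(maximalRealSubfield L))) ϖF !![(0 : v.adicCompletion ↥(maximalRealSubfield L)), 1; -1, 0] M}) :
    rhoVertexActPlace L v w hw hα hα0 hϖF u M = N ↔ glVertexAct (isUniformizingElement_of_v_eq hϖF) g M = N := by
  rw [rhoVertexActPlace_eq_iff_exists_zpow L v w hw hα hα0 hϖF u hs hsg M N, glVertexAct_eq_iff]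

include hv₀ in
/-- **√u-TYPE VERTEX over `ρ_w`**: for `α` an anti-fixed unit, `∀ u ∈ U_w, u ∈ GL₂(𝒪_w) ↔ ρ_w(u) · v₀ = v₀` — the `hKv` binder of ★ p843743
`epEllipticRelation_vertexEdgeLevels_of_vertexAction_local'` ∕ of ★ `rankOneEulerPoincareNonsplit_of_treeActions` (√u branch). [cite: Tits1979, §2.7 and §3.9]
[cite: Serre1980Trees, Ch. II §1.3] -/
theorem forall_coe_mem_glInt_iff_rhoVertexActPlace_root_eq (hvα : Valued.v α = 1) :
    ∀ u : ↥(unitaryGroupOfForm (galAdicCompletionMap (L := L) (IsCMField.complexConj L) hw)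
      (placeForm (Matrix.of fun i j : Fin 2 => if i.val + j.val + 1 = 2 then (1 : L) else 0) w.1)),
      (u : GL (Fin 2) (w.1.adicCompletion L)) ∈ glInt 2 (w.1.adicCompletion L) ↔ rhoVertexActPlace L v w hw hα hα0 hϖF u v₀ = v₀ := by
  haveI : IsDiscreteValuationRing 𝒪[v.adicCompletion ↥(maximalRealSubfield L)] := isDiscreteValuationRing_integer_of_compatible hϖF
  intro u
  obtain ⟨s, g, hs, hsg⟩ := descent_of_mem_unitaryGroupOfForm_antidiag L v w hw hα hα0 _ (coe_mem_unitaryGroupOfForm_antidiag_two_of_mem_placeForm L w hw u)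
  rw [rhoVertexActPlace_eq_iff_glVertexAct_eq L v w hw hα hα0 hϖF u hs hsg]
  exact coe_mem_glInt_iff_glVertexAct_root_eq_of_v_eq_one L w hw (isUniformizingElement_of_v_eq hϖF) hϖF v₀ hv₀ hvα u hsg

include hv₀ hv₁ in
/-- **√u-TYPE EDGE over `ρ_w`** (`w` ramified, `η` any uniformiser): `∀ u ∈ U_w, u ∈ diag(1,η) GL₂(𝒪_w) diag(1,η)⁻¹ ↔ s(ρ_w(u)·v₀, ρ_w(u)·v₁) = s(v₀, v₁)` — the
`hKe` binder (√u branch). [cite: Tits1979, §2.7 and §3.9] [cite: Serre1980Trees, Ch. II §1.3] [cite: Kottwitz1988, §2] -/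
theorem forall_coe_mem_map_conj_glDiagonal_iff_sym2_rhoVertexActPlace_eq (he : v.asIdeal.ramificationIdx' w.1.asIdeal ≠ 1) (hvα : Valued.v α = 1)
    (η : (w.1.adicCompletion L)ˣ) (hη : Valued.v (η : w.1.adicCompletion L) = exp (-1 : ℤ)) :
    ∀ u : ↥(unitaryGroupOfForm (galAdicCompletionMap (L := L) (IsCMField.complexConj L) hw)
      (placeForm (Matrix.of fun i j : Fin 2 => if i.val + j.val + 1 = 2 then (1 : L) else 0) w.1)),
      (u : GL (Fin 2) (w.1.adicCompletion L)) ∈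
          (glInt 2 (w.1.adicCompletion L)).map (MulAut.conj (glDiagonal 2 (w.1.adicCompletion L) ![1, η])).toMonoidHom ↔
        s(rhoVertexActPlace L v w hw hα hα0 hϖF u v₀, rhoVertexActPlace L v w hw hα hα0 hϖF u v₁) = s(v₀, v₁) := by
  haveI : IsDiscreteValuationRing 𝒪[v.adicCompletion ↥(maximalRealSubfield L)] := isDiscreteValuationRing_integer_of_compatible hϖF
  intro u
  obtain ⟨s, g, hs, hsg⟩ := descent_of_mem_unitaryGroupOfForm_antidiag L v w hw hα hα0 _ (coe_mem_unitaryGroupOfForm_antidiag_two_of_mem_placeForm L w hw u)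
  have e0 : rhoVertexActPlace L v w hw hα hα0 hϖF u v₀ = glVertexAct (isUniformizingElement_of_v_eq hϖF) g v₀ :=
    (rhoVertexActPlace_eq_iff_glVertexAct_eq L v w hw hα hα0 hϖF u hs hsg v₀ _).2 rfl
  have e1 : rhoVertexActPlace L v w hw hα hα0 hϖF u v₁ = glVertexAct (isUniformizingElement_of_v_eq hϖF) g v₁ :=
    (rhoVertexActPlace_eq_iff_glVertexAct_eq L v w hw hα hα0 hϖF u hs hsg v₁ _).2 rfl
  rw [e0, e1]
  exact coe_mem_map_conj_glDiagonal_iff_sym2_glVertexAct_eq_of_v_eq_one L w hw (isUniformizingElement_of_v_eq hϖF) hϖF v₀ v₁ hv₀ hv₁ he hvα η hη u hsg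

include hv₁ in
/-- **√π-TYPE VERTEX over `ρ_w`** (`w` ramified, `α` an anti-fixed uniformiser, `η` any uniformiser): `∀ u ∈ U_w, u ∈ diag(1,η) GL₂(𝒪_w) diag(1,η)⁻¹ ↔
ρ_w(u) · v₁ = v₁` — the `hKv` binder of ★ p843743 `_local` ∕ of the junction (√π branch, `x₀ = v₁`). [cite: Tits1979, §2.7 and §3.9] [cite: Serre1980Trees, Ch. II §1.3]
[cite: Kottwitz1988, §2] -/
theorem forall_coe_mem_map_conj_glDiagonal_iff_rhoVertexActPlace_next_eq (he : v.asIdeal.ramificationIdx' w.1.asIdeal ≠ 1)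
    (hvα : Valued.v α = exp (-1 : ℤ)) (η : (w.1.adicCompletion L)ˣ) (hη : Valued.v (η : w.1.adicCompletion L) = exp (-1 : ℤ)) :
    ∀ u : ↥(unitaryGroupOfForm (galAdicCompletionMap (L := L) (IsCMField.complexConj L) hw)
      (placeForm (Matrix.of fun i j : Fin 2 => if i.val + j.val + 1 = 2 then (1 : L) else 0) w.1)),
      (u : GL (Fin 2) (w.1.adicCompletion L)) ∈
          (glInt 2 (w.1.adicCompletion L)).map (MulAut.conj (glDiagonal 2 (w.1.adicCompletion L) ![1, η])).toMonoidHom ↔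
        rhoVertexActPlace L v w hw hα hα0 hϖF u v₁ = v₁ := by
  haveI : IsDiscreteValuationRing 𝒪[v.adicCompletion ↥(maximalRealSubfield L)] := isDiscreteValuationRing_integer_of_compatible hϖF
  intro u
  obtain ⟨s, g, hs, hsg⟩ := descent_of_mem_unitaryGroupOfForm_antidiag L v w hw hα hα0 _ (coe_mem_unitaryGroupOfForm_antidiag_two_of_mem_placeForm L w hw u)
  rw [rhoVertexActPlace_eq_iff_glVertexAct_eq L v w hw hα hα0 hϖF u hs hsg]
  exact coe_mem_map_conj_glDiagonal_iff_glVertexAct_next_eq_of_v_eq_exp_neg_one L w hw (isUniformizingElement_of_v_eq hϖF) hϖF v₁ hv₁ he hvα η hη u hsg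

include hv₀ hv₁ in
/-- **√π-TYPE EDGE over `ρ_w`** (`w` ramified, `α` an anti-fixed uniformiser): `∀ u ∈ U_w, u ∈ GL₂(𝒪_w) ↔ s(ρ_w(u)·v₁, ρ_w(u)·v₀) = s(v₁, v₀)` — the `hKe`
binder (√π branch, base dart `(v₁, v₀)`). [cite: Tits1979, §2.7 and §3.9] [cite: Serre1980Trees, Ch. II §1.3] [cite: Kottwitz1988, §2] -/
theorem forall_coe_mem_glInt_iff_sym2_rhoVertexActPlace_eq (he : v.asIdeal.ramificationIdx' w.1.asIdeal ≠ 1) (hvα : Valued.v α = exp (-1 : ℤ)) :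
    ∀ u : ↥(unitaryGroupOfForm (galAdicCompletionMap (L := L) (IsCMField.complexConj L) hw)
      (placeForm (Matrix.of fun i j : Fin 2 => if i.val + j.val + 1 = 2 then (1 : L) else 0) w.1)),
      (u : GL (Fin 2) (w.1.adicCompletion L)) ∈ glInt 2 (w.1.adicCompletion L) ↔
        s(rhoVertexActPlace L v w hw hα hα0 hϖF u v₁, rhoVertexActPlace L v w hw hα hα0 hϖF u v₀) = s(v₁, v₀) := by
  haveI : IsDiscreteValuationRing 𝒪[v.adicCompletion ↥(maximalRealSubfield L)] := isDiscreteValuationRing_integer_of_compatible hϖF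
  intro u
  obtain ⟨s, g, hs, hsg⟩ := descent_of_mem_unitaryGroupOfForm_antidiag L v w hw hα hα0 _ (coe_mem_unitaryGroupOfForm_antidiag_two_of_mem_placeForm L w hw u)
  have e0 : rhoVertexActPlace L v w hw hα hα0 hϖF u v₀ = glVertexAct (isUniformizingElement_of_v_eq hϖF) g v₀ :=
    (rhoVertexActPlace_eq_iff_glVertexAct_eq L v w hw hα hα0 hϖF u hs hsg v₀ _).2 rfl
  have e1 : rhoVertexActPlace L v w hw hα hα0 hϖF u v₁ = glVertexAct (isUniformizingElement_of_v_eq hϖF) g v₁ :=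
    (rhoVertexActPlace_eq_iff_glVertexAct_eq L v w hw hα hα0 hϖF u hs hsg v₁ _).2 rfl
  rw [e0, e1]
  exact coe_mem_glInt_iff_sym2_glVertexAct_eq_of_v_eq_exp_neg_one L w hw (isUniformizingElement_of_v_eq hϖF) hϖF v₀ v₁ hv₀ hv₁ he hvα u hsg

end Place

end Literature.NumberTheory.Automorphic.UnitaryGroup
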